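import Literature.MathematicalPhysics.QuantumFieldTheory.Balaban1983to89.B1Eq324BenfattoKernelEq324UnitRange
import Literature.MathematicalPhysics.QuantumFieldTheory.Balaban1983to89.B1Eq324BenfattoKernelEq324AnyGamma
import HarnessLib

/-!
# `Balaban1983to89.B1Eq324BenfattoKernelEq324AnyGammaUnitRange` — [Balaban1982Higgs1] (3.24) for the Gaussian field of EVERY class member, ANY
# `γ_A > 0`, at EVERY coupling `η ∈ (0,1]` (seat n08-d's `…KernelEq324UnitRange.eq324_kernel_noPad_on_unit` ∘ the field rescaling of
# `…ClassRescale`; and the Sect. E currency edition) — PROVED, no definition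

statement-level companion of a published source with citation tags; every declaration here is a theorem; nothing here is
a claim about the Yang–Mills mass gap

WHY THIS MODULE (cell `pub-ymgap`, seat `dag-n08-b` gen 14, INTENT-6; node N08 [Balaban1985UV3]).  Seat n08-w4's (α)-socket wants the class road's
(3.24) at EVERY run step `k ≤ K`, i.e. for every coupling `g_k ∈ (0,1]`, not only below an `η₀` (`…RowClassSocketAllSteps`); seat n08-d's
`…KernelEq324UnitRange.eq324_kernel_noPad_on_unit` delivers that under print's normalisation `2 ≤ γ_A` (threshold window `b₁ < b₀` displayed,
via seat n08-w4's `…Eq324UnitRange.errTerm_pFun_le_on_unit`).  This file removes the normalisation exactly as `…KernelEq324AnyGamma` did below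
`η₀`: run the supplier on the scaled member `(Λ, λ²A, λ⁻²K)` at threshold constant `b₀/λ` (window `λ b₁ < b₀`) and read the conclusion back
through `…ClassRescale` (`pFun_div`, `integral_cutoffBoltzmann_scaled_kernel_eq`, `cumulantSum_scaled_kernel_eq`); then the Sect. E currency
edition with the rate and rows chosen from `(γ_A, K_A, κ_A, d)` as in `…KernelEq324AnyGamma` §2.

WHAT IS PROVED (standard axioms; no `sorry`; no definition).
* ★★★ `eq324_kernel_noPad_anyGamma_on_unit` — `eq324_kernel_noPad_on_unit` VERBATIM with `(hγA0 : 0 < γA)` in place of `(hγA2 : 2 ≤ γA)`.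
* ★★★ `eq324_kernel_of_expDecay_on_unit` — the same with the member's three rows replaced by ONE decay hypothesis `|A e e′| ≤ K_A e^{−κ_A|e−e′|₂}`.
HONEST SCOPE.  Composition by name of landed theorems of this cell for OUR class form; the window `b₁ < b₀` is a genuine record-vs-class proviso
(displayed, not decided); the IDENT at [Balaban1985UV3]'s objects is NOT commissioned and NOT claimed; count-neutral for N08; nothing about
d = 4, the continuum, OS axioms, a mass gap or the Clay problem.
-/

noncomputable section

open MeasureTheory Finset Matrix

namespace Literature.MathematicalPhysics.QuantumFieldTheory.Balaban1983to89.B1Eq324BenfattoKernelEq324AnyGammaUnitRange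

open Literature.MathematicalPhysics.QuantumFieldTheory
open Literature.MathematicalPhysics.QuantumFieldTheory.Balaban1983to89.B1Eq324BenfattoLemma
open Literature.MathematicalPhysics.QuantumFieldTheory.Balaban1983to89.B1Eq324BenfattoKernelEq324UnitRange (eq324_kernel_noPad_on_unit)
open Literature.MathematicalPhysics.QuantumFieldTheory.Balaban1983to89.B1Eq324BenfattoClassRescale
open Literature.MathematicalPhysics.QuantumFieldTheory.Balaban1983to89.B1Eq324BenfattoClassEntryRows
  (classRow_Jc_le_of_abs_le_exp classRow_M_le_of_abs_le_exp classRow_M₂_le_of_abs_le_exp)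

variable {d : ℕ}

/-- ★★★ **(3.24) FOR THE GAUSSIAN FIELD OF EVERY CLASS MEMBER, ANY `γ_A > 0`, EVERY COUPLING `η ∈ (0,1]`, NO PAD** — for `0 < d`, constants
`0 < γ_A`, `0 ≤ J_c < γ_A`, `θ > 0`, `M, M₂ ≥ 0`, every `t D`, `ϰ > 0`, `p₀ > 2/3`, `σ > 0`, `c ≥ 0`, `0 < κ < σ(t+1)`: there is a threshold window
`b₁` such that for every `b₀ > b₁` there is `C ≥ 0` with: for all `η ∈ (0,1]`, every member `(Λ, A, K)` (`hK`, `Λ ≠ ∅`, symmetric, `γ_A`-coercive,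
rows `J_c, M, M₂`) and every `(s, I, J, a)` with `I ≠ ∅`, `J ⊆ I`, `J ⊆ Λ`, `coefSup ≤ c·η^σ`:
`0 < ∫Π_Δχ̂_{p(η)}e^{H_J}dμ_K ∧ |log ∫Π_Δχ̂_{p(η)}e^{H_J}dμ_K − cumulantSum μ_K H_J t| ≤ C·η^κ·|I|`.
Proof: seat n08-d's `eq324_kernel_noPad_on_unit` at the scaled constants on the scaled member at `b₀/λ` (window `b₁ := λ·b₁′`), read back by
`…ClassRescale`. [cite: Balaban1982Higgs1, (3.24) p.616; BenfattoEtAl1978, Lemma (4.5)–(4.7) p.152 «E z_Δ² = ½»; Balaban1985UV3, (7) p.257;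
Balaban1985BackgroundPropagators, Sect. E p.428 (class form; ours)] -/
theorem eq324_kernel_noPad_anyGamma_on_unit (hd : 0 < d) {γA Jc θ M M₂ : ℝ} (hγA0 : 0 < γA) (hJc0 : 0 ≤ Jc) (hJcγ : Jc < γA)
    (hθ : 0 < θ) (hM0 : 0 ≤ M) (hM₂0 : 0 ≤ M₂)
    (t D : ℕ) {ϰ : ℝ} (hϰ : 0 < ϰ) {p₀ σ c κ : ℝ} (hp₀ : 2 / 3 < p₀) (hσ : 0 < σ) (hc : 0 ≤ c) (hκ : 0 < κ)
    (hκσ : κ < σ * (t + 1)) :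
    ∃ b₁ : ℝ, ∀ b₀ : ℝ, b₁ < b₀ → ∃ C : ℝ, 0 ≤ C ∧ ∀ η : ℝ, 0 < η → η ≤ 1 →
      ∀ {Λ : Finset (B1Eq324BenfattoLemma.Site d)} {A : Matrix Λ Λ ℝ} {K : B1Eq324BenfattoLemma.Site d → B1Eq324BenfattoLemma.Site d → ℝ},
        (∀ x y, K x y = if h : x ∈ Λ ∧ y ∈ Λ then (A⁻¹ : Matrix Λ Λ ℝ) ⟨x, h.1⟩ ⟨y, h.2⟩ else 0) → Λ.Nonempty →
        (∀ e e', A e e' = A e' e) → (∀ x : Λ → ℝ, γA * ∑ e, x e ^ 2 ≤ ∑ e, ∑ e', A e e' * x e * x e') →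
        (∀ e : Λ, ∑ e' : Λ, |A e e'| * (Real.cosh (θ * Real.sqrt (∑ j, ((((e : B1Eq324BenfattoLemma.Site d) j : ℝ) - ((e' : B1Eq324BenfattoLemma.Site d) j : ℝ))) ^ 2)) - 1) ≤ Jc) →
        (∀ e : Λ, ∑ e' : Λ, |A e e'| * (1 + Real.sqrt (∑ j, ((((e : B1Eq324BenfattoLemma.Site d) j : ℝ) - ((e' : B1Eq324BenfattoLemma.Site d) j : ℝ))) ^ 2)) ≤ M) →
        (∀ e : Λ, ∑ e' : Λ, |A e e'| * Real.exp (θ / 2 * Real.sqrt (∑ j, ((((e : B1Eq324BenfattoLemma.Site d) j : ℝ) - ((e' : B1Eq324BenfattoLemma.Site d) j : ℝ))) ^ 2)) ≤ M₂) →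
        ∀ (s : ℕ) (I J : Finset (B1Eq324BenfattoLemma.Site d)) (a : Coef d), I.Nonempty → J ⊆ I → J ⊆ Λ →
          coefSup s D a J ≤ c * η ^ σ →
          0 < ∫ z, cutoffBoltzmann (hamiltonian s D ϰ a J) I (B10.pFun b₀ p₀ η) z ∂gaussianFieldOfKernel K ∧
            |Real.log (∫ z, cutoffBoltzmann (hamiltonian s D ϰ a J) I (B10.pFun b₀ p₀ η) z ∂gaussianFieldOfKernel K) -
                cumulantSum (gaussianFieldOfKernel K) (hamiltonian s D ϰ a J) t| ≤ C * η ^ κ * I.card := by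
  -- the normalising scale
  obtain ⟨lam, hlam1, hhalf⟩ := exists_normalising_scale hγA0
  have hlam : 0 < lam := lt_of_lt_of_le one_pos hlam1
  have hr0 : 0 < lam ^ 2 := pow_pos hlam 2
  have hγA2 : 2 ≤ lam ^ 2 * γA := (one_div_le_one_div (mul_pos hr0 hγA0) two_pos).mp hhalf
  have hc' : 0 ≤ (max 1 lam) ^ D * c := mul_nonneg (pow_nonneg (le_trans zero_le_one (le_max_left _ _)) _) hc
  -- seat n08-d's all-η theorem at the scaled constants
  obtain ⟨b₁, hb₁⟩ :=
    eq324_kernel_noPad_on_unit (d := d) hd hγA2 (mul_nonneg hr0.le hJc0) (mul_lt_mul_of_pos_left hJcγ hr0) hθ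
      (mul_nonneg hr0.le hM0) (mul_nonneg hr0.le hM₂0) t D hϰ hp₀ hσ hc' hκ hκσ
  refine ⟨lam * b₁, fun b₀ hb₀ => ?_⟩
  have hwin : b₁ < b₀ / lam := by
    rw [lt_div_iff₀ hlam]
    linarith [mul_comm lam b₁]
  obtain ⟨C, hC, hE⟩ := hb₁ (b₀ / lam) hwin
  refine ⟨C, hC, fun η hη hηle Λ A K hK hΛ hAs hγA hJc hM hM₂ s I J a hI hJI hJΛ hA => ?_⟩
  have hKpsd : IsPosSemidefKernel K := isPosSemidefKernel_of_member hK hAs hγA0 hγA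
  have hA' : coefSup s D (fun p Δ n => lam ^ (∑ i, n i) * a p Δ n) J ≤ (max 1 lam) ^ D * c * η ^ σ := by
    refine (coefSup_scale_le s D a J lam).trans ?_
    rw [abs_of_pos hlam, mul_assoc]
    exact mul_le_mul_of_nonneg_left hA (pow_nonneg (le_trans zero_le_one (le_max_left _ _)) _)
  have key := hE η hη hηle (Λ := Λ) (A := lam ^ 2 • A) (K := fun x y => (lam ^ 2)⁻¹ * K x y)
    (kernel_smul hK hAs hγA0 hγA hr0.ne') hΛ (symm_smul hAs _) (coercive_smul hγA hr0.le)
    (rowBound_smul hJc hr0.le) (rowBound_smul hM hr0.le) (rowBound_smul hM₂ hr0.le)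
    s I J (fun p Δ n => lam ^ (∑ i, n i) * a p Δ n) hI hJI hJΛ hA'
  rw [pFun_div, integral_cutoffBoltzmann_scaled_kernel_eq hKpsd a J I _ hlam, cumulantSum_scaled_kernel_eq hKpsd a J hlam t] at key
  exact key

/-- kernel: the rate choice — for `γ_A > 0`, `K_A ≥ 0`, `κ_A > 0`, `K_d ≥ 0` the rate `θ := min (κ_A/4) (min 1 (γ_A κ_A²/(64 (K_A K_d + 1))))` is positive,
`≤ κ_A/4`, and the decay Combes–Thomas row `K_A·(32θ²/κ_A²)·K_d` is at most `γ_A/2`. [folklore] -/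
private theorem rate_choice' {γA KA κA Kd : ℝ} (hγA0 : 0 < γA) (hKA : 0 ≤ KA) (hκA : 0 < κA) (hKd : 0 ≤ Kd) :
    0 < min (κA / 4) (min 1 (γA * κA ^ 2 / (64 * (KA * Kd + 1)))) ∧
      min (κA / 4) (min 1 (γA * κA ^ 2 / (64 * (KA * Kd + 1)))) ≤ κA / 4 ∧
      KA * (32 * (min (κA / 4) (min 1 (γA * κA ^ 2 / (64 * (KA * Kd + 1))))) ^ 2 / κA ^ 2) * Kd ≤ γA / 2 := by
  set θ := min (κA / 4) (min 1 (γA * κA ^ 2 / (64 * (KA * Kd + 1)))) with hθdef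
  have hP : 0 < KA * Kd + 1 := by positivity
  have hq0 : 0 < γA * κA ^ 2 / (64 * (KA * Kd + 1)) := by positivity
  have hθ0 : 0 < θ := lt_min (by positivity) (lt_min one_pos hq0)
  have hθ1 : θ ≤ 1 := (min_le_right _ _).trans (min_le_left _ _)
  have hθq : θ ≤ γA * κA ^ 2 / (64 * (KA * Kd + 1)) := (min_le_right _ _).trans (min_le_right _ _)
  refine ⟨hθ0, min_le_left _ _, ?_⟩
  have hsq : θ ^ 2 ≤ γA * κA ^ 2 / (64 * (KA * Kd + 1)) := by
    rw [sq]
    calc θ * θ ≤ 1 * (γA * κA ^ 2 / (64 * (KA * Kd + 1))) := mul_le_mul hθ1 hθq hθ0.le zero_le_one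
      _ = _ := one_mul _
  have hκ2 : 0 < κA ^ 2 := by positivity
  calc KA * (32 * θ ^ 2 / κA ^ 2) * Kd ≤ KA * (32 * (γA * κA ^ 2 / (64 * (KA * Kd + 1))) / κA ^ 2) * Kd := by
        refine mul_le_mul_of_nonneg_right (mul_le_mul_of_nonneg_left ?_ hKA) hKd
        exact div_le_div_of_nonneg_right (mul_le_mul_of_nonneg_left hsq (by norm_num)) hκ2.le
    _ = γA / 2 * (KA * Kd / (KA * Kd + 1)) := by
        field_simp
        ring
    _ ≤ γA / 2 * 1 := mul_le_mul_of_nonneg_left ((div_le_one hP).mpr (by linarith)) (by positivity)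
    _ = γA / 2 := mul_one _

/-- ★★★ **(3.24) IN SECT. E's CURRENCY AT EVERY COUPLING `η ∈ (0,1]`** — symmetric, `γ_A`-coercive (`γ_A > 0`), `|A e e′| ≤ K_A e^{−κ_A|e−e′|₂}`;
the rate and the rows `J_c, M, M₂` derived inside from `(γ_A, K_A, κ_A, d)` (seat n08-d's `…ClassEntryRows` §4); window `b₁ < b₀` displayed.
[cite: Balaban1982Higgs1, (3.24) p.616; BenfattoEtAl1978, Lemma (4.5)–(4.7) p.152, Appendix C (C.1)–(C.2) p.164;
Balaban1985BackgroundPropagators, (1.16)–(1.18) p.180, Sect. E p.428 (class form; ours)] -/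
theorem eq324_kernel_of_expDecay_on_unit (hd : 0 < d) {γA KA κA : ℝ} (hγA0 : 0 < γA) (hKA : 0 ≤ KA) (hκA : 0 < κA)
    (t D : ℕ) {ϰ : ℝ} (hϰ : 0 < ϰ) {p₀ σ c κ : ℝ} (hp₀ : 2 / 3 < p₀) (hσ : 0 < σ) (hc : 0 ≤ c) (hκ : 0 < κ)
    (hκσ : κ < σ * (t + 1)) :
    ∃ b₁ : ℝ, ∀ b₀ : ℝ, b₁ < b₀ → ∃ C : ℝ, 0 ≤ C ∧ ∀ η : ℝ, 0 < η → η ≤ 1 →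
      ∀ {Λ : Finset (B1Eq324BenfattoLemma.Site d)} {A : Matrix Λ Λ ℝ} {K : B1Eq324BenfattoLemma.Site d → B1Eq324BenfattoLemma.Site d → ℝ},
        (∀ x y, K x y = if h : x ∈ Λ ∧ y ∈ Λ then (A⁻¹ : Matrix Λ Λ ℝ) ⟨x, h.1⟩ ⟨y, h.2⟩ else 0) → Λ.Nonempty →
        (∀ e e', A e e' = A e' e) → (∀ x : Λ → ℝ, γA * ∑ e, x e ^ 2 ≤ ∑ e, ∑ e', A e e' * x e * x e') →
        (∀ e e' : Λ, |A e e'| ≤ KA * Real.exp (-(κA * Real.sqrt (∑ j, ((((e : B1Eq324BenfattoLemma.Site d) j : ℝ) - ((e' : B1Eq324BenfattoLemma.Site d) j : ℝ))) ^ 2)))) →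
        ∀ (s : ℕ) (I J : Finset (B1Eq324BenfattoLemma.Site d)) (a : Coef d), I.Nonempty → J ⊆ I → J ⊆ Λ →
          coefSup s D a J ≤ c * η ^ σ →
          0 < ∫ z, cutoffBoltzmann (hamiltonian s D ϰ a J) I (B10.pFun b₀ p₀ η) z ∂gaussianFieldOfKernel K ∧
            |Real.log (∫ z, cutoffBoltzmann (hamiltonian s D ϰ a J) I (B10.pFun b₀ p₀ η) z ∂gaussianFieldOfKernel K) -
                cumulantSum (gaussianFieldOfKernel K) (hamiltonian s D ϰ a J) t| ≤ C * η ^ κ * I.card := by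
  have hKd : 0 ≤ (2 / (1 - Real.exp (-(κA / 2 / Real.sqrt d))) * Real.exp (κA / 2 / Real.sqrt d)) ^ d := by
    refine pow_nonneg (mul_nonneg (div_nonneg zero_le_two ?_) (Real.exp_pos _).le) _
    rw [sub_nonneg, Real.exp_le_one_iff, neg_nonpos]
    positivity
  obtain ⟨hθ0, hθκ4, hJcle⟩ := rate_choice' hγA0 hKA hκA hKd
  set θ := min (κA / 4) (min 1 (γA * κA ^ 2 / (64 * (KA * ((2 / (1 - Real.exp (-(κA / 2 / Real.sqrt d))) * Real.exp (κA / 2 / Real.sqrt d)) ^ d) + 1))))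
    with hθdef
  have hθκ : θ ≤ κA := hθκ4.trans (by linarith)
  have hJc0 : 0 ≤ KA * (32 * θ ^ 2 / κA ^ 2) * ((2 / (1 - Real.exp (-(κA / 2 / Real.sqrt d))) * Real.exp (κA / 2 / Real.sqrt d)) ^ d) := by
    positivity
  have hJcγ : KA * (32 * θ ^ 2 / κA ^ 2) * ((2 / (1 - Real.exp (-(κA / 2 / Real.sqrt d))) * Real.exp (κA / 2 / Real.sqrt d)) ^ d) < γA :=
    hJcle.trans_lt (by linarith)
  have hM0 : 0 ≤ KA * ((1 + 2 / κA) * (2 / (1 - Real.exp (-(κA / 2 / Real.sqrt d))) * Real.exp (κA / 2 / Real.sqrt d)) ^ d) := by positivity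
  have hM₂0 : 0 ≤ KA * (2 / (1 - Real.exp (-(κA / 2 / Real.sqrt d))) * Real.exp (κA / 2 / Real.sqrt d)) ^ d := mul_nonneg hKA hKd
  obtain ⟨b₁, hb₁⟩ := eq324_kernel_noPad_anyGamma_on_unit (d := d) hd hγA0 hJc0 hJcγ hθ0 hM0 hM₂0 t D hϰ hp₀ hσ hc hκ hκσ
  refine ⟨b₁, fun b₀ hb₀ => ?_⟩
  obtain ⟨C, hC, hE⟩ := hb₁ b₀ hb₀
  refine ⟨C, hC, fun η hη hηle Λ A K hK hΛ hAs hγA hdec s I J a hI hJI hJΛ hA => ?_⟩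
  exact hE η hη hηle hK hΛ hAs hγA (classRow_Jc_le_of_abs_le_exp hKA hκA hθ0.le hθκ4 hdec) (classRow_M_le_of_abs_le_exp hKA hκA hdec)
    (classRow_M₂_le_of_abs_le_exp hKA hκA hθκ hdec) s I J a hI hJI hJΛ hA

end Literature.MathematicalPhysics.QuantumFieldTheory.Balaban1983to89.B1Eq324BenfattoKernelEq324AnyGammaUnitRange
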